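import Summits.Ventures.CertifiedManyBodySolver.Observables.NeelClassKineticFloor
import Summits.Ventures.CertifiedManyBodySolver.Observables.MeanFieldClassExclusionStrip
import Summits.Ventures.CertifiedManyBodySolver.Certificates.HubbardSquare_n7o8_upper_dbt299plaqRS_row524
import HarnessLib

/-!
# Ventures/CertifiedManyBodySolver — Observables/NeelClassExclusionA0.lean

HONEST FRAMING: first certified bounds; not a superconductivity verdict; every number certified or labelled float.
A competing-order EXCLUSION removes a named class of candidate ground states; it never says which order is present;
no phase sentence follows.

Cell `hubbard-tc` (MO-S3, D-0096), seat `hubbard-tc-mod-3` (G3: competing orders — stripe/CDW/AF — as EXCLUSION inputs from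
certified energy ORDERINGS), `prover-hubbard-tc-mod-3-g7-0`. **The AF item of the seat's row: «Néel (antiferromagnetic)
MEAN-FIELD CLASS excluded» words, as ENERGY ORDERINGS.** The class (any even torus `(ℤ/Lℤ)²`, any particle-number mixture):
Fock vectors of mean density `n`, staggered magnetisation `m` (`Re⟨Ô⟩ = 2mL²‖φ‖²`, `Ô = Σ_x (−1)^{x₁+x₂}(n_{x↑} − n_{x↓})`) and
AT LEAST THE HARTREE DOUBLE OCCUPANCY OF THEIR OWN NÉEL ORDER, `Re⟨D̂⟩ ≥ (n²/4 − m²)L²‖φ‖²` — it contains every collinear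
two-sublattice (Néel / spin-density-wave) Hartree–Fock Slater state with uniform sublattice moments (Wick: equality), every
non-magnetic quasi-free and singlet-paired BCS state (`m = 0`, the MF/BCS class of the seat's earlier words) and every correlated
state whose double-occupancy deficit below `(n/2)²` is no larger than `m²`; it does NOT contain stripes / spirals with modulated
moment size. The KERNEL floor (hypothesis-free, `NeelClassKineticFloor.lean`): energy per site
`≥ 2δ|m| + δ(1 − n) − √(4 + δ²) + U(n²/4 − m²)` for every admissible `δ` (`t′ ≤ 0`). The WORDS compare it with CERTIFIED
ground-state energy CEILINGS of the sr-mbsolver GRID (claim nodes, BY HYPOTHESIS — each word is exactly as strong as its cap):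

* `neelClass_energy_ge_A0` — `(8, 7/8, 0)`, cap #524: gap `≥ 3/25 = 0.12·t` (floor `−0.5801` vs `−0.7120`);
* `neelClass_energy_ge_A0_Uwindow` — `t′ = 0`, `n = 7/8`, `U ∈ [7, 17/2]`: gap `≥ 3/100`;
* `neelClass_energy_ge_A0_tPrimeWindow` — `U = 8`, `n = 7/8`, `t′ ∈ [−1/20, 0]`: gap `≥ 1/25`;
* `neelClass_energy_ge_A0prime` — `(8, 7/8, −1/4)`, cap #445: gap `≥ 9/100` (floor `−0.5801` vs `−0.6866`);
* `neelClass_energy_ge_A0prime_tPrimeWindow` — `U = 8`, `n = 7/8`, `t′ ∈ [−27/100, −23/100]`: gap `≥ 3/100`;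
* other densities `(8, 4/5 | 3/4 | 1, 0)`: `NeelClassExclusionDensities.lean` (gaps `11/100`, `1/25`, `1/256`).

Reading: "no state of the Néel mean-field class on any even torus comes within the stated gap (per site, units of `t`) of the
thermodynamic ground-state energy density `e₀(1, t′, U, n)`" — in particular the antiferromagnetic Hartree–Fock description is
certified-excluded as the ground state at these cuprate-regime points, quantitatively. Float context (designer
`hubbard-tc-mod-3` g7 `work/neel/`): exact self-consistent Néel-HF energies `E_AFHF(8,7/8,0) ≈ −0.527`, `(8,7/8,−1/4) ≈ −0.512`,
`(8,4/5,0) ≈ −0.571`, `(8,3/4,0) ≈ −0.605`, `(8,1,0) ≈ −0.466` [float]; the kernel floor is the Jensen/Cauchy–Schwarz relaxation of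
the SDW band sum (loses `≈ 0.05·t` at the binding moment). Proofs: piecewise-constant `δ` over `|m|`-pieces (`2|m| ≤ n`), `linarith`.
WHAT THIS IS NOT: a statement that antiferromagnetic ORDER is absent (correlated Néel-ordered states with a larger docc deficit are
outside the class); a statement about stripes, d-wave order or T_c; a phase word.

References: V. Bach, E. H. Lieb, J. P. Solovej, J. Stat. Phys. 76 (1994) 3, §2 eq. (2c.36) [BachLiebSolovej1994]; E. H. Lieb,
M. Loss, Duke Math. J. 71 (1993) 337, §8 Thm 8.2 [LiebLoss1993]; J. S. Langer, D. C. Mattis, Phys. Lett. 36A (1971) 139 [LangerMattis1971];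
R. B. Israel, Convexity in the Theory of Lattice Gases (1979), Thm I.3.4 [Israel1979]; T. Koma, H. Tasaki, J. Stat. Phys. 76 (1994) 745,
§1 [KomaTasaki1994]; D. Ruelle, Statistical Mechanics (1969) §3.3 [Ruelle1969]; H. Xu et al., Science 384 (2024) eadh7691 [XuEtAl2024].
-/

noncomputable section

namespace Summit.Ventures.CertifiedManyBodySolver.Observables

open Literature.MathematicalPhysics.QuantumLattice
open Literature.MathematicalPhysics.QuantumLattice.ThermodynamicLimit
open Summit.Ventures.CertifiedManyBodySolver.Certificates
open Matrix Finset Literature.Probability.LatticeModels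
  Literature.MathematicalPhysics.QuantumLattice.RayleighBound
  Literature.MathematicalPhysics.QuantumLattice.LangerMattis
  Literature.MathematicalPhysics.QuantumLattice.HartreeFock
  NeelClassFloor
open scoped ComplexOrder

variable {L : ℕ} [NeZero L]

/-- The CERTIFIED #524 cap as a decimal: `e₀(1, 0, 8, 7/8) ≤ −0.7119916754` (claim node `cert_dbt299plaqRS_allk`, k-free transport
`m3_tp0_upper_dbt299plaqRS_allk_of`, exact endpoint `−12525490015723/2⁴⁴`; outward rounding). [cite: Ruelle1969, §3.3] -/
theorem a0_cap524_decimal_of (hRS : cert_dbt299plaqRS_allk) :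
    energyDensityTT' 1 0 8 (7 / 8) ≤ -0.7119916754 := by
  have h := m3_tp0_upper_dbt299plaqRS_allk_of hRS
  unfold M3EnergyUpperRow at h
  refine h.trans ?_
  push_cast
  norm_num

/-- **A0 — Néel mean-field class excluded at `(U, n, t′) = (8, 7/8, 0)` with a `0.12·t` gap** (conditional on the
CERTIFIED cap #524 BY HYPOTHESIS, claim node `cert_dbt299plaqRS_allk`: `e₀(1,0,8,7/8) ≤ −0.7119916754`). On every even torus
`(ℤ/Lℤ)²`, `L ≥ 4`, every Fock vector `φ ≠ 0` of mean density `7/8` whose double occupancy is at least the Hartree value of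
its own staggered magnetisation `m` (`Re⟨D̂⟩ ≥ (49/256 − m²)L²‖φ‖²`; every collinear two-sublattice Hartree–Fock state, every
non-magnetic quasi-free / singlet-BCS state) has energy per site `≥ e₀(1, 0, 8, 7/8) + 3/25`: no state of the Néel mean-field
class comes within `0.12·t` per site of the ground-state energy density. Kernel floor `neelClass_energy_per_site_ge`
(hypothesis-free), five `δ`-pieces in `|m|` (binding `|m| ≈ 0.34`, floor `−0.5801`, exact slack ≥ 0.0066).
[cite: BachLiebSolovej1994, §2 eq. (2c.36)] [cite: LiebLoss1993, §8, Theorem 8.2] -/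
theorem neelClass_energy_ge_A0 (hRS : cert_dbt299plaqRS_allk) (hL : 3 ≤ L) (hLe : Even L) {m : ℝ}
    {φ : Fock (Orb (FermionTorus 2 L))} (hφ : φ ≠ 0)
    (hN : (star φ ⬝ᵥ (totalNumber *ᵥ φ)).re = 7 / 8 * (L : ℝ) ^ 2 * normSq φ)
    (hO : (star φ ⬝ᵥ ((dGammaSpin 0 (stagMatrix 2 L) - dGammaSpin 1 (stagMatrix 2 L)) *ᵥ φ)).re =
      2 * m * (L : ℝ) ^ 2 * normSq φ)
    (hD : ((7 / 8 : ℝ) ^ 2 / 4 - m ^ 2) * (L : ℝ) ^ 2 * normSq φ ≤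
      (star φ ⬝ᵥ ((∑ x : FermionTorus 2 L, numberOp x 0 * numberOp x 1) *ᵥ φ)).re) :
    energyDensityTT' 1 0 8 (7 / 8) + 3 / 25 ≤
      (star φ ⬝ᵥ (hubbardTorusTT' L 1 0 8 *ᵥ φ)).re / ((L : ℝ) ^ 2 * normSq φ) := by
  have hcap := a0_cap524_decimal_of hRS
  have hm : 2 * |m| ≤ 7 / 8 := two_abs_stag_le_density hφ hN hO
  have h0 : 0 ≤ |m| := abs_nonneg m
  have hsq : m ^ 2 = |m| ^ 2 := (sq_abs m).symm
  have key : ∀ δ : ℝ, 0 < δ → 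
      2 * δ * |m| + δ * (1 - 7 / 8) - Real.sqrt (4 * (1 : ℝ) ^ 2 + δ ^ 2) + 8 * ((7 / 8 : ℝ) ^ 2 / 4 - |m| ^ 2) ≤
        (star φ ⬝ᵥ (hubbardTorusTT' L 1 0 8 *ᵥ φ)).re / ((L : ℝ) ^ 2 * normSq φ) := by
    intro δ hδ
    have h := neelClass_energy_per_site_ge hL hLe 1 (t' := 0) (U := 8) le_rfl (by norm_num) hδ
      (by rw [abs_zero]; linarith) (by rw [abs_zero]; norm_num) hφ hN hO hD
    rw [hsq] at h
    exact h
  rcases le_or_gt |m| (7 / 64) with c1 | c1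
  · -- piece 1: |m| ∈ [0, 7/64], δ = 11/25, √(4+δ²) ≤ 2047829/1000000 (slack 0.1304)
    have h := key (11 / 25) (by norm_num)
    have hr : Real.sqrt (4 * (1 : ℝ) ^ 2 + (11 / 25 : ℝ) ^ 2) ≤ 2047829 / 1000000 :=
      (Real.sqrt_le_sqrt (by norm_num)).trans_eq (Real.sqrt_sq (by norm_num))
    linarith [mul_nonneg h0 (sub_nonneg.2 c1), h, hr, hcap]
  rcases le_or_gt |m| (7 / 32) with c2 | c2
  · -- piece 2: |m| ∈ [7/64, 7/32], δ = 131/100, √(4+δ²) ≤ 2390837/1000000 (slack 0.0865)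
    have h := key (131 / 100) (by norm_num)
    have hr : Real.sqrt (4 * (1 : ℝ) ^ 2 + (131 / 100 : ℝ) ^ 2) ≤ 2390837 / 1000000 :=
      (Real.sqrt_le_sqrt (by norm_num)).trans_eq (Real.sqrt_sq (by norm_num))
    linarith [mul_nonneg (sub_nonneg.2 c1.le) (sub_nonneg.2 c2), h, hr, hcap]
  rcases le_or_gt |m| (21 / 64) with c3 | c3
  · -- piece 3: |m| ∈ [7/32, 21/64], δ = 109/50, √(4+δ²) ≤ 1479223/500000 (slack 0.0066)
    have h := key (109 / 50) (by norm_num)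
    have hr : Real.sqrt (4 * (1 : ℝ) ^ 2 + (109 / 50 : ℝ) ^ 2) ≤ 1479223 / 500000 :=
      (Real.sqrt_le_sqrt (by norm_num)).trans_eq (Real.sqrt_sq (by norm_num))
    linarith [mul_nonneg (sub_nonneg.2 c2.le) (sub_nonneg.2 c3), h, hr, hcap]
  rcases le_or_gt |m| (49 / 128) with c4 | c4
  · -- piece 4: |m| ∈ [21/64, 49/128], δ = 57/20, √(4+δ²) ≤ 3481739/1000000 (slack 0.0067)
    have h := key (57 / 20) (by norm_num)
    have hr : Real.sqrt (4 * (1 : ℝ) ^ 2 + (57 / 20 : ℝ) ^ 2) ≤ 3481739 / 1000000 :=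
      (Real.sqrt_le_sqrt (by norm_num)).trans_eq (Real.sqrt_sq (by norm_num))
    linarith [mul_nonneg (sub_nonneg.2 c3.le) (sub_nonneg.2 c4), h, hr, hcap]
  -- piece 5: |m| ∈ [49/128, 7/16], δ = 98/25, √(4+δ²) ≤ 550091/125000 (slack 0.0414)
  have h := key (98 / 25) (by norm_num)
  have hr : Real.sqrt (4 * (1 : ℝ) ^ 2 + (98 / 25 : ℝ) ^ 2) ≤ 550091 / 125000 :=
    (Real.sqrt_le_sqrt (by norm_num)).trans_eq (Real.sqrt_sq (by norm_num))
  linarith [mul_nonneg (sub_nonneg.2 c4.le) (sub_nonneg.2 (show |m| ≤ 7 / 16 by linarith)), h, hr, hcap]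

/-- **A0 column, `U`-window `[7, 17/2]`** (conditional on #524 BY HYPOTHESIS; cap transported by monotonicity in `U` below 8 and by
the Hartree–Fock slope `49/256` above, `strip78_cap_of_anchor`): at `t′ = 0`, `n = 7/8`, every `U ∈ [7, 17/2]`, every state of
the Néel mean-field class on every even torus has energy per site `≥ e₀(1, 0, U, 7/8) + 3/100`. Margins: `+0.044` at `U = 7`
(floor `−0.668`), `+0.132` at `U = 8`, `+0.071` at `U = 17/2` (exact slack ≥ 0.0089 / 0.020 over the pieces).
[cite: BachLiebSolovej1994, §2 eq. (2c.36)] [cite: KomaTasaki1994, §1] -/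
theorem neelClass_energy_ge_A0_Uwindow (hRS : cert_dbt299plaqRS_allk) {U : ℝ} (hU7 : 7 ≤ U) (hU : U ≤ 17 / 2) (hL : 3 ≤ L) (hLe : Even L) {m : ℝ}
    {φ : Fock (Orb (FermionTorus 2 L))} (hφ : φ ≠ 0)
    (hN : (star φ ⬝ᵥ (totalNumber *ᵥ φ)).re = 7 / 8 * (L : ℝ) ^ 2 * normSq φ)
    (hO : (star φ ⬝ᵥ ((dGammaSpin 0 (stagMatrix 2 L) - dGammaSpin 1 (stagMatrix 2 L)) *ᵥ φ)).re =
      2 * m * (L : ℝ) ^ 2 * normSq φ)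
    (hD : ((7 / 8 : ℝ) ^ 2 / 4 - m ^ 2) * (L : ℝ) ^ 2 * normSq φ ≤
      (star φ ⬝ᵥ ((∑ x : FermionTorus 2 L, numberOp x 0 * numberOp x 1) *ᵥ φ)).re) :
    energyDensityTT' 1 0 U (7 / 8) + 3 / 100 ≤
      (star φ ⬝ᵥ (hubbardTorusTT' L 1 0 U *ᵥ φ)).re / ((L : ℝ) ^ 2 * normSq φ) := by
  have hcap := a0_cap524_decimal_of hRS
  have hm : 2 * |m| ≤ 7 / 8 := two_abs_stag_le_density hφ hN hO
  have h0 : 0 ≤ |m| := abs_nonneg m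
  have hsq : m ^ 2 = |m| ^ 2 := (sq_abs m).symm
  have key : ∀ δ : ℝ, 0 < δ → 
      2 * δ * |m| + δ * (1 - 7 / 8) - Real.sqrt (4 * (1 : ℝ) ^ 2 + δ ^ 2) + U * ((7 / 8 : ℝ) ^ 2 / 4 - |m| ^ 2) ≤
        (star φ ⬝ᵥ (hubbardTorusTT' L 1 0 U *ᵥ φ)).re / ((L : ℝ) ^ 2 * normSq φ) := by
    intro δ hδ
    have h := neelClass_energy_per_site_ge hL hLe 1 (t' := 0) (U := U) le_rfl (by linarith) hδ
      (by rw [abs_zero]; linarith) (by rw [abs_zero]; norm_num) hφ hN hO hD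
    rw [hsq] at h
    exact h
  have hcapU : energyDensityTT' 1 0 U (7 / 8) ≤ -0.7119916754 + 49 / 256 * max (U - 8) 0 := by
    have h := strip78_cap_of_anchor (s₀ := 0) hcap 0 (U := U) (by linarith)
    rw [sub_self, abs_zero, mul_zero, add_zero] at h
    exact h
  have hmsq : |m| ^ 2 ≤ (7 / 16 : ℝ) ^ 2 := by nlinarith [h0, hm]
  rcases le_total U 8 with hU8 | hU8
  · rw [max_eq_right (by linarith : U - 8 ≤ 0), mul_zero, add_zero] at hcapU
    have hUm : 0 ≤ (U - 7) * ((7 / 16 : ℝ) ^ 2 - |m| ^ 2) := mul_nonneg (by linarith) (by linarith)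
    rcases le_or_gt |m| (7 / 64) with c1 | c1
    · -- piece 1: |m| ∈ [0, 7/64], δ = 19/50, √(4+δ²) ≤ 101789/50000 (slack 0.0329)
      have h := key (19 / 50) (by norm_num)
      have hr : Real.sqrt (4 * (1 : ℝ) ^ 2 + (19 / 50 : ℝ) ^ 2) ≤ 101789 / 50000 :=
        (Real.sqrt_le_sqrt (by norm_num)).trans_eq (Real.sqrt_sq (by norm_num))
      linarith [mul_nonneg h0 (sub_nonneg.2 c1), h, hr, hcapU, hUm, hU7, hU8]
    rcases le_or_gt |m| (7 / 32) with c2 | c2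
    · -- piece 2: |m| ∈ [7/64, 7/32], δ = 23/20, √(4+δ²) ≤ 461411/200000 (slack 0.0264)
      have h := key (23 / 20) (by norm_num)
      have hr : Real.sqrt (4 * (1 : ℝ) ^ 2 + (23 / 20 : ℝ) ^ 2) ≤ 461411 / 200000 :=
        (Real.sqrt_le_sqrt (by norm_num)).trans_eq (Real.sqrt_sq (by norm_num))
      linarith [mul_nonneg (sub_nonneg.2 c1.le) (sub_nonneg.2 c2), h, hr, hcapU, hUm, hU7, hU8]
    rcases le_or_gt |m| (35 / 128) with c3 | c3
    · -- piece 3: |m| ∈ [7/32, 35/128], δ = 43/25, √(4+δ²) ≤ 1318939/500000 (slack 0.0162)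
      have h := key (43 / 25) (by norm_num)
      have hr : Real.sqrt (4 * (1 : ℝ) ^ 2 + (43 / 25 : ℝ) ^ 2) ≤ 1318939 / 500000 :=
        (Real.sqrt_le_sqrt (by norm_num)).trans_eq (Real.sqrt_sq (by norm_num))
      linarith [mul_nonneg (sub_nonneg.2 c2.le) (sub_nonneg.2 c3), h, hr, hcapU, hUm, hU7, hU8]
    rcases le_or_gt |m| (21 / 64) with c4 | c4
    · -- piece 4: |m| ∈ [35/128, 21/64], δ = 211/100, √(4+δ²) ≤ 11629/4000 (slack 0.0089)
      have h := key (211 / 100) (by norm_num)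
      have hr : Real.sqrt (4 * (1 : ℝ) ^ 2 + (211 / 100 : ℝ) ^ 2) ≤ 11629 / 4000 :=
        (Real.sqrt_le_sqrt (by norm_num)).trans_eq (Real.sqrt_sq (by norm_num))
      linarith [mul_nonneg (sub_nonneg.2 c3.le) (sub_nonneg.2 c4), h, hr, hcapU, hUm, hU7, hU8]
    -- piece 5: |m| ∈ [21/64, 7/16], δ = 67/25, √(4+δ²) ≤ 334401/100000 (slack 0.0179)
    have h := key (67 / 25) (by norm_num)
    have hr : Real.sqrt (4 * (1 : ℝ) ^ 2 + (67 / 25 : ℝ) ^ 2) ≤ 334401 / 100000 :=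
      (Real.sqrt_le_sqrt (by norm_num)).trans_eq (Real.sqrt_sq (by norm_num))
    linarith [mul_nonneg (sub_nonneg.2 c4.le) (sub_nonneg.2 (show |m| ≤ 7 / 16 by linarith)), h, hr, hcapU, hUm, hU7, hU8]
  · rw [max_eq_left (by linarith : (0:ℝ) ≤ U - 8)] at hcapU
    have hUm : 0 ≤ (17 / 2 - U) * |m| ^ 2 := mul_nonneg (by linarith) (sq_nonneg _)
    rcases le_or_gt |m| (7 / 64) with c1 | c1
    · -- piece 1: |m| ∈ [0, 7/64], δ = 47/100, √(4+δ²) ≤ 2054483/1000000 (slack 0.2175)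
      have h := key (47 / 100) (by norm_num)
      have hr : Real.sqrt (4 * (1 : ℝ) ^ 2 + (47 / 100 : ℝ) ^ 2) ≤ 2054483 / 1000000 :=
        (Real.sqrt_le_sqrt (by norm_num)).trans_eq (Real.sqrt_sq (by norm_num))
      linarith [mul_nonneg h0 (sub_nonneg.2 c1), h, hr, hcapU, hUm, hU, hU8]
    rcases le_or_gt |m| (7 / 32) with c2 | c2
    · -- piece 2: |m| ∈ [7/64, 7/32], δ = 34/25, √(4+δ²) ≤ 483719/200000 (slack 0.1529)
      have h := key (34 / 25) (by norm_num)
      have hr : Real.sqrt (4 * (1 : ℝ) ^ 2 + (34 / 25 : ℝ) ^ 2) ≤ 483719 / 200000 :=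
        (Real.sqrt_le_sqrt (by norm_num)).trans_eq (Real.sqrt_sq (by norm_num))
      linarith [mul_nonneg (sub_nonneg.2 c1.le) (sub_nonneg.2 c2), h, hr, hcapU, hUm, hU, hU8]
    rcases le_or_gt |m| (21 / 64) with c3 | c3
    · -- piece 3: |m| ∈ [7/32, 21/64], δ = 58/25, √(4+δ²) ≤ 3063071/1000000 (slack 0.0475)
      have h := key (58 / 25) (by norm_num)
      have hr : Real.sqrt (4 * (1 : ℝ) ^ 2 + (58 / 25 : ℝ) ^ 2) ≤ 3063071 / 1000000 :=
        (Real.sqrt_le_sqrt (by norm_num)).trans_eq (Real.sqrt_sq (by norm_num))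
      linarith [mul_nonneg (sub_nonneg.2 c2.le) (sub_nonneg.2 c3), h, hr, hcapU, hUm, hU, hU8]
    -- piece 4: |m| ∈ [21/64, 7/16], δ = 163/50, √(4+δ²) ≤ 764921/200000 (slack 0.0204)
    have h := key (163 / 50) (by norm_num)
    have hr : Real.sqrt (4 * (1 : ℝ) ^ 2 + (163 / 50 : ℝ) ^ 2) ≤ 764921 / 200000 :=
      (Real.sqrt_le_sqrt (by norm_num)).trans_eq (Real.sqrt_sq (by norm_num))
    linarith [mul_nonneg (sub_nonneg.2 c3.le) (sub_nonneg.2 (show |m| ≤ 7 / 16 by linarith)), h, hr, hcapU, hUm, hU, hU8]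

/-- **A0′ — Néel mean-field class excluded at `(8, 7/8, −1/4)` with a `0.09·t` gap** (conditional on the CERTIFIED cap #445 BY
HYPOTHESIS, claim node `cert_dbt329pair_allk`: `e₀(1,−1/4,8,7/8) ≤ −0.6866417849`). For `t′ = −1/4 ≤ 0` the kernel floor is the
SAME as at `t′ = 0` (the hole-doped band top stays at `−|Δ|`; admissible `δ ∈ [1, 15/2]`): every state of the Néel mean-field class
on every even torus has energy per site `≥ e₀(1, −1/4, 8, 7/8) + 9/100` (floor `−0.5801`, margin `+0.1065`, slack ≥ 0.011).
[cite: BachLiebSolovej1994, §2 eq. (2c.36)] [cite: XuEtAl2024, eq. (1)] -/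
theorem neelClass_energy_ge_A0prime (h445 : cert_dbt329pair_allk) (hL : 3 ≤ L) (hLe : Even L) {m : ℝ}
    {φ : Fock (Orb (FermionTorus 2 L))} (hφ : φ ≠ 0)
    (hN : (star φ ⬝ᵥ (totalNumber *ᵥ φ)).re = 7 / 8 * (L : ℝ) ^ 2 * normSq φ)
    (hO : (star φ ⬝ᵥ ((dGammaSpin 0 (stagMatrix 2 L) - dGammaSpin 1 (stagMatrix 2 L)) *ᵥ φ)).re =
      2 * m * (L : ℝ) ^ 2 * normSq φ)
    (hD : ((7 / 8 : ℝ) ^ 2 / 4 - m ^ 2) * (L : ℝ) ^ 2 * normSq φ ≤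
      (star φ ⬝ᵥ ((∑ x : FermionTorus 2 L, numberOp x 0 * numberOp x 1) *ᵥ φ)).re) :
    energyDensityTT' 1 (-1 / 4) 8 (7 / 8) + 9 / 100 ≤
      (star φ ⬝ᵥ (hubbardTorusTT' L 1 (-1 / 4) 8 *ᵥ φ)).re / ((L : ℝ) ^ 2 * normSq φ) := by
  have hcap := m3_tpm1o4_cap_decimal_of h445
  have hq : |(-1 / 4 : ℝ)| = 1 / 4 := by rw [abs_of_neg (by norm_num)]; norm_num
  have hm : 2 * |m| ≤ 7 / 8 := two_abs_stag_le_density hφ hN hO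
  have h0 : 0 ≤ |m| := abs_nonneg m
  have hsq : m ^ 2 = |m| ^ 2 := (sq_abs m).symm
  have key : ∀ δ : ℝ, 0 < δ → 1 ≤ δ → δ ≤ 15 / 2 →
      2 * δ * |m| + δ * (1 - 7 / 8) - Real.sqrt (4 * (1 : ℝ) ^ 2 + δ ^ 2) + 8 * ((7 / 8 : ℝ) ^ 2 / 4 - |m| ^ 2) ≤
        (star φ ⬝ᵥ (hubbardTorusTT' L 1 (-1 / 4) 8 *ᵥ φ)).re / ((L : ℝ) ^ 2 * normSq φ) := by
    intro δ hδ hδ1 hδ2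
    have h := neelClass_energy_per_site_ge hL hLe 1 (t' := (-1 / 4)) (U := 8) (by norm_num) (by norm_num) hδ
      (by rw [hq]; linarith [hδ1]) (by rw [hq]; linarith [hδ2]) hφ hN hO hD
    rw [hsq] at h
    exact h
  rcases le_or_gt |m| (7 / 64) with c1 | c1
  · -- piece 1: |m| ∈ [0, 7/64], δ = 1, √(4+δ²) ≤ 559017/250000 (slack 0.0168)
    have h := key (1) (by norm_num) (by norm_num) (by norm_num)
    have hr : Real.sqrt (4 * (1 : ℝ) ^ 2 + (1 : ℝ) ^ 2) ≤ 559017 / 250000 :=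
      (Real.sqrt_le_sqrt (by norm_num)).trans_eq (Real.sqrt_sq (by norm_num))
    linarith [mul_nonneg h0 (sub_nonneg.2 c1), h, hr, hcap]
  rcases le_or_gt |m| (7 / 32) with c2 | c2
  · -- piece 2: |m| ∈ [7/64, 7/32], δ = 131/100, √(4+δ²) ≤ 2390837/1000000 (slack 0.0911)
    have h := key (131 / 100) (by norm_num) (by norm_num) (by norm_num)
    have hr : Real.sqrt (4 * (1 : ℝ) ^ 2 + (131 / 100 : ℝ) ^ 2) ≤ 2390837 / 1000000 :=
      (Real.sqrt_le_sqrt (by norm_num)).trans_eq (Real.sqrt_sq (by norm_num))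
    linarith [mul_nonneg (sub_nonneg.2 c1.le) (sub_nonneg.2 c2), h, hr, hcap]
  rcases le_or_gt |m| (21 / 64) with c3 | c3
  · -- piece 3: |m| ∈ [7/32, 21/64], δ = 109/50, √(4+δ²) ≤ 1479223/500000 (slack 0.0112)
    have h := key (109 / 50) (by norm_num) (by norm_num) (by norm_num)
    have hr : Real.sqrt (4 * (1 : ℝ) ^ 2 + (109 / 50 : ℝ) ^ 2) ≤ 1479223 / 500000 :=
      (Real.sqrt_le_sqrt (by norm_num)).trans_eq (Real.sqrt_sq (by norm_num))
    linarith [mul_nonneg (sub_nonneg.2 c2.le) (sub_nonneg.2 c3), h, hr, hcap]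
  rcases le_or_gt |m| (49 / 128) with c4 | c4
  · -- piece 4: |m| ∈ [21/64, 49/128], δ = 57/20, √(4+δ²) ≤ 3481739/1000000 (slack 0.0114)
    have h := key (57 / 20) (by norm_num) (by norm_num) (by norm_num)
    have hr : Real.sqrt (4 * (1 : ℝ) ^ 2 + (57 / 20 : ℝ) ^ 2) ≤ 3481739 / 1000000 :=
      (Real.sqrt_le_sqrt (by norm_num)).trans_eq (Real.sqrt_sq (by norm_num))
    linarith [mul_nonneg (sub_nonneg.2 c3.le) (sub_nonneg.2 c4), h, hr, hcap]
  -- piece 5: |m| ∈ [49/128, 7/16], δ = 98/25, √(4+δ²) ≤ 550091/125000 (slack 0.0461)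
  have h := key (98 / 25) (by norm_num) (by norm_num) (by norm_num)
  have hr : Real.sqrt (4 * (1 : ℝ) ^ 2 + (98 / 25 : ℝ) ^ 2) ≤ 550091 / 125000 :=
    (Real.sqrt_le_sqrt (by norm_num)).trans_eq (Real.sqrt_sq (by norm_num))
  linarith [mul_nonneg (sub_nonneg.2 c4.le) (sub_nonneg.2 (show |m| ≤ 7 / 16 by linarith)), h, hr, hcap]

/-- **A0 column, `t′`-window `[−1/20, 0]` at `U = 8`** (conditional on #524 BY HYPOTHESIS; cap transported by the kinematic `t′`-law
`|Δe| ≤ 1.6212·|Δt′|`, `strip78_cap_of_anchor`): every state of the Néel mean-field class at density `7/8` on every even torus has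
energy per site `≥ e₀(1, t′, 8, 7/8) + 1/25` for every `t′ ∈ [−1/20, 0]` (margin `0.132 − 0.081`, slack ≥ 0.0055).
[cite: BachLiebSolovej1994, §2 eq. (2c.36)] [cite: Israel1979, Thm. I.3.4] -/
theorem neelClass_energy_ge_A0_tPrimeWindow (hRS : cert_dbt299plaqRS_allk) {t' : ℝ} (ht1 : -1 / 20 ≤ t') (ht0 : t' ≤ 0) (hL : 3 ≤ L) (hLe : Even L) {m : ℝ}
    {φ : Fock (Orb (FermionTorus 2 L))} (hφ : φ ≠ 0)
    (hN : (star φ ⬝ᵥ (totalNumber *ᵥ φ)).re = 7 / 8 * (L : ℝ) ^ 2 * normSq φ)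
    (hO : (star φ ⬝ᵥ ((dGammaSpin 0 (stagMatrix 2 L) - dGammaSpin 1 (stagMatrix 2 L)) *ᵥ φ)).re =
      2 * m * (L : ℝ) ^ 2 * normSq φ)
    (hD : ((7 / 8 : ℝ) ^ 2 / 4 - m ^ 2) * (L : ℝ) ^ 2 * normSq φ ≤
      (star φ ⬝ᵥ ((∑ x : FermionTorus 2 L, numberOp x 0 * numberOp x 1) *ᵥ φ)).re) :
    energyDensityTT' 1 t' 8 (7 / 8) + 1 / 25 ≤
      (star φ ⬝ᵥ (hubbardTorusTT' L 1 t' 8 *ᵥ φ)).re / ((L : ℝ) ^ 2 * normSq φ) := by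
  have hcap0 := a0_cap524_decimal_of hRS
  have hcap : energyDensityTT' 1 t' 8 (7 / 8) ≤ -0.7119916754 + 1.6212 * (1 / 20) := by
    have h := strip78_cap_of_anchor (s₀ := 0) hcap0 t' (U := 8) (by norm_num)
    have habs : |t' - 0| ≤ 1 / 20 := by rw [sub_zero, abs_of_nonpos ht0]; linarith
    have hmax : max ((8 : ℝ) - 8) 0 = 0 := by norm_num
    rw [hmax, mul_zero, add_zero] at h
    linarith [h, habs]
  have hta : |t'| = -t' := abs_of_nonpos ht0
  have hm : 2 * |m| ≤ 7 / 8 := two_abs_stag_le_density hφ hN hO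
  have h0 : 0 ≤ |m| := abs_nonneg m
  have hsq : m ^ 2 = |m| ^ 2 := (sq_abs m).symm
  have key : ∀ δ : ℝ, 0 < δ → 1 / 5 ≤ δ → δ ≤ 12 →
      2 * δ * |m| + δ * (1 - 7 / 8) - Real.sqrt (4 * (1 : ℝ) ^ 2 + δ ^ 2) + 8 * ((7 / 8 : ℝ) ^ 2 / 4 - |m| ^ 2) ≤
        (star φ ⬝ᵥ (hubbardTorusTT' L 1 t' 8 *ᵥ φ)).re / ((L : ℝ) ^ 2 * normSq φ) := by
    intro δ hδ hδ1 hδ2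
    have h := neelClass_energy_per_site_ge hL hLe 1 (t' := t') (U := 8) ht0 (by norm_num) hδ
      (by rw [hta]; linarith) (by rw [hta]; linarith [mul_nonneg (sub_nonneg.2 hδ2) (neg_nonneg.2 ht0), mul_nonneg (show (0:ℝ) ≤ t' + 1 / 20 by linarith) (neg_nonneg.2 ht0)]) hφ hN hO hD
    rw [hsq] at h
    exact h
  rcases le_or_gt |m| (7 / 64) with c1 | c1
  · -- piece 1: |m| ∈ [0, 7/64], δ = 11/25, √(4+δ²) ≤ 2047829/1000000 (slack 0.1294)
    have h := key (11 / 25) (by norm_num) (by norm_num) (by norm_num)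
    have hr : Real.sqrt (4 * (1 : ℝ) ^ 2 + (11 / 25 : ℝ) ^ 2) ≤ 2047829 / 1000000 :=
      (Real.sqrt_le_sqrt (by norm_num)).trans_eq (Real.sqrt_sq (by norm_num))
    linarith [mul_nonneg h0 (sub_nonneg.2 c1), h, hr, hcap]
  rcases le_or_gt |m| (7 / 32) with c2 | c2
  · -- piece 2: |m| ∈ [7/64, 7/32], δ = 131/100, √(4+δ²) ≤ 2390837/1000000 (slack 0.0854)
    have h := key (131 / 100) (by norm_num) (by norm_num) (by norm_num)
    have hr : Real.sqrt (4 * (1 : ℝ) ^ 2 + (131 / 100 : ℝ) ^ 2) ≤ 2390837 / 1000000 :=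
      (Real.sqrt_le_sqrt (by norm_num)).trans_eq (Real.sqrt_sq (by norm_num))
    linarith [mul_nonneg (sub_nonneg.2 c1.le) (sub_nonneg.2 c2), h, hr, hcap]
  rcases le_or_gt |m| (21 / 64) with c3 | c3
  · -- piece 3: |m| ∈ [7/32, 21/64], δ = 109/50, √(4+δ²) ≤ 1479223/500000 (slack 0.0055)
    have h := key (109 / 50) (by norm_num) (by norm_num) (by norm_num)
    have hr : Real.sqrt (4 * (1 : ℝ) ^ 2 + (109 / 50 : ℝ) ^ 2) ≤ 1479223 / 500000 :=
      (Real.sqrt_le_sqrt (by norm_num)).trans_eq (Real.sqrt_sq (by norm_num))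
    linarith [mul_nonneg (sub_nonneg.2 c2.le) (sub_nonneg.2 c3), h, hr, hcap]
  rcases le_or_gt |m| (49 / 128) with c4 | c4
  · -- piece 4: |m| ∈ [21/64, 49/128], δ = 57/20, √(4+δ²) ≤ 3481739/1000000 (slack 0.0057)
    have h := key (57 / 20) (by norm_num) (by norm_num) (by norm_num)
    have hr : Real.sqrt (4 * (1 : ℝ) ^ 2 + (57 / 20 : ℝ) ^ 2) ≤ 3481739 / 1000000 :=
      (Real.sqrt_le_sqrt (by norm_num)).trans_eq (Real.sqrt_sq (by norm_num))
    linarith [mul_nonneg (sub_nonneg.2 c3.le) (sub_nonneg.2 c4), h, hr, hcap]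
  -- piece 5: |m| ∈ [49/128, 7/16], δ = 98/25, √(4+δ²) ≤ 550091/125000 (slack 0.0403)
  have h := key (98 / 25) (by norm_num) (by norm_num) (by norm_num)
  have hr : Real.sqrt (4 * (1 : ℝ) ^ 2 + (98 / 25 : ℝ) ^ 2) ≤ 550091 / 125000 :=
    (Real.sqrt_le_sqrt (by norm_num)).trans_eq (Real.sqrt_sq (by norm_num))
  linarith [mul_nonneg (sub_nonneg.2 c4.le) (sub_nonneg.2 (show |m| ≤ 7 / 16 by linarith)), h, hr, hcap]

/-- **A0′ column, `t′`-window `[−27/100, −23/100]` at `U = 8`** (conditional on #445 BY HYPOTHESIS; kinematic `t′`-transport from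
`−1/4`): every state of the Néel mean-field class at density `7/8` on every even torus has energy per site
`≥ e₀(1, t′, 8, 7/8) + 3/100` for every `t′ ∈ [−27/100, −23/100]` (admissible `δ ∈ [27/25, 6]`; slack ≥ 0.017).
[cite: BachLiebSolovej1994, §2 eq. (2c.36)] [cite: Israel1979, Thm. I.3.4] -/
theorem neelClass_energy_ge_A0prime_tPrimeWindow (h445 : cert_dbt329pair_allk) {t' : ℝ} (ht1 : -27 / 100 ≤ t') (ht0 : t' ≤ -23 / 100) (hL : 3 ≤ L) (hLe : Even L) {m : ℝ}
    {φ : Fock (Orb (FermionTorus 2 L))} (hφ : φ ≠ 0)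
    (hN : (star φ ⬝ᵥ (totalNumber *ᵥ φ)).re = 7 / 8 * (L : ℝ) ^ 2 * normSq φ)
    (hO : (star φ ⬝ᵥ ((dGammaSpin 0 (stagMatrix 2 L) - dGammaSpin 1 (stagMatrix 2 L)) *ᵥ φ)).re =
      2 * m * (L : ℝ) ^ 2 * normSq φ)
    (hD : ((7 / 8 : ℝ) ^ 2 / 4 - m ^ 2) * (L : ℝ) ^ 2 * normSq φ ≤
      (star φ ⬝ᵥ ((∑ x : FermionTorus 2 L, numberOp x 0 * numberOp x 1) *ᵥ φ)).re) :
    energyDensityTT' 1 t' 8 (7 / 8) + 3 / 100 ≤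
      (star φ ⬝ᵥ (hubbardTorusTT' L 1 t' 8 *ᵥ φ)).re / ((L : ℝ) ^ 2 * normSq φ) := by
  have hcap0 := m3_tpm1o4_cap_decimal_of h445
  have ht0' : t' ≤ 0 := by linarith
  have hcap : energyDensityTT' 1 t' 8 (7 / 8) ≤ -0.6866417849 + 1.6212 * (1 / 50) := by
    have h := strip78_cap_of_anchor (s₀ := -1 / 4) hcap0 t' (U := 8) (by norm_num)
    have habs : |t' - (-1 / 4)| ≤ 1 / 50 := abs_le.2 ⟨by linarith, by linarith⟩
    have hmax : max ((8 : ℝ) - 8) 0 = 0 := by norm_num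
    rw [hmax, mul_zero, add_zero] at h
    linarith [h, habs]
  have hta : |t'| = -t' := abs_of_nonpos ht0'
  have hm : 2 * |m| ≤ 7 / 8 := two_abs_stag_le_density hφ hN hO
  have h0 : 0 ≤ |m| := abs_nonneg m
  have hsq : m ^ 2 = |m| ^ 2 := (sq_abs m).symm
  have key : ∀ δ : ℝ, 0 < δ → 27 / 25 ≤ δ → δ ≤ 6 →
      2 * δ * |m| + δ * (1 - 7 / 8) - Real.sqrt (4 * (1 : ℝ) ^ 2 + δ ^ 2) + 8 * ((7 / 8 : ℝ) ^ 2 / 4 - |m| ^ 2) ≤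
        (star φ ⬝ᵥ (hubbardTorusTT' L 1 t' 8 *ᵥ φ)).re / ((L : ℝ) ^ 2 * normSq φ) := by
    intro δ hδ hδ1 hδ2
    have h := neelClass_energy_per_site_ge hL hLe 1 (t' := t') (U := 8) ht0' (by norm_num) hδ
      (by rw [hta]; linarith) (by rw [hta]; linarith [mul_nonneg (sub_nonneg.2 hδ2) (neg_nonneg.2 ht0'), mul_nonneg (show (0:ℝ) ≤ t' + 27 / 100 by linarith) (neg_nonneg.2 ht0')]) hφ hN hO hD
    rw [hsq] at h
    exact h
  rcases le_or_gt |m| (7 / 64) with c1 | c1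
  · -- piece 1: |m| ∈ [0, 7/64], δ = 27/25, √(4+δ²) ≤ 568243/250000 (slack 0.0175)
    have h := key (27 / 25) (by norm_num) (by norm_num) (by norm_num)
    have hr : Real.sqrt (4 * (1 : ℝ) ^ 2 + (27 / 25 : ℝ) ^ 2) ≤ 568243 / 250000 :=
      (Real.sqrt_le_sqrt (by norm_num)).trans_eq (Real.sqrt_sq (by norm_num))
    linarith [mul_nonneg h0 (sub_nonneg.2 c1), h, hr, hcap]
  rcases le_or_gt |m| (7 / 32) with c2 | c2
  · -- piece 2: |m| ∈ [7/64, 7/32], δ = 131/100, √(4+δ²) ≤ 2390837/1000000 (slack 0.1187)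
    have h := key (131 / 100) (by norm_num) (by norm_num) (by norm_num)
    have hr : Real.sqrt (4 * (1 : ℝ) ^ 2 + (131 / 100 : ℝ) ^ 2) ≤ 2390837 / 1000000 :=
      (Real.sqrt_le_sqrt (by norm_num)).trans_eq (Real.sqrt_sq (by norm_num))
    linarith [mul_nonneg (sub_nonneg.2 c1.le) (sub_nonneg.2 c2), h, hr, hcap]
  rcases le_or_gt |m| (21 / 64) with c3 | c3
  · -- piece 3: |m| ∈ [7/32, 21/64], δ = 109/50, √(4+δ²) ≤ 1479223/500000 (slack 0.0388)
    have h := key (109 / 50) (by norm_num) (by norm_num) (by norm_num)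
    have hr : Real.sqrt (4 * (1 : ℝ) ^ 2 + (109 / 50 : ℝ) ^ 2) ≤ 1479223 / 500000 :=
      (Real.sqrt_le_sqrt (by norm_num)).trans_eq (Real.sqrt_sq (by norm_num))
    linarith [mul_nonneg (sub_nonneg.2 c2.le) (sub_nonneg.2 c3), h, hr, hcap]
  -- piece 4: |m| ∈ [21/64, 7/16], δ = 153/50, √(4+δ²) ≤ 1827813/500000 (slack 0.0286)
  have h := key (153 / 50) (by norm_num) (by norm_num) (by norm_num)
  have hr : Real.sqrt (4 * (1 : ℝ) ^ 2 + (153 / 50 : ℝ) ^ 2) ≤ 1827813 / 500000 :=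
    (Real.sqrt_le_sqrt (by norm_num)).trans_eq (Real.sqrt_sq (by norm_num))
  linarith [mul_nonneg (sub_nonneg.2 c3.le) (sub_nonneg.2 (show |m| ≤ 7 / 16 by linarith)), h, hr, hcap]

end Summit.Ventures.CertifiedManyBodySolver.Observables

end
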